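import Summits.BirchSwinnertonDyer.BirchSwinnertonDyer.Theorems.ErratumRoadFiveNonSurjCornerHybridPoitouTateKernel
import HarnessLib

/-!
# Route `ErratumRoadFive` (rung K2), crux `NonSurjCorner` (item stmt-BirchSwinnertonDyer-19065): THE r16 LINE KEYED ON ROUTE ITEMS —
# what a «closes modulo route items» glue for 19065 looks like TODAY, and exactly which binders are NOT yet item-stated
# (cell `bsd-stepL`, seat `bsd-stepL-corner-p1` g17; `--supports stmt-BirchSwinnertonDyer-19065 --as helper`; offered to the planner, cf. RULING 65 (c) for 19715)

WHY THIS FILE. After r16 the hybrid line has SIX stubs and no structural residual (glue #18, `…HybridPoitouTateKernel`). RULING 65 (c) itemises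
19715's two remaining inputs so that ITS crux closes modulo route items. THIS FILE shows the same shape for 19065 with the route AS IT IS: every
binder that is ALREADY a decl of `Theses/ErratumRoadFive.lean` is taken BY NAME — `NonSurjCornerKolyZ` (19946; it implies slot 1's deep ∕ `Ш_an`-cut
form a fortiori), `NonSurjCornerTwinMuAn` (19948), `PublishedInputsFive` (19066: GZ, Kolyvagin, Wuthrich, GZK, modularity ×2, FH split ∕ inert, Mazur),
`ShimuraParametrizationDataNonempty`, `PastenComponentOrdersInput`, `ShimuraCasselsTateLevelInputs` — and the binders that are NOT item-stated
are DISPLAYED verbatim (an alternative for slot 4 — the crux `X11aLowerHalf` (19064) BY NAME, as r5 did — is described below, not built):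
* `hF3` — r16's fifteen-fact slot 3 (= the text RULING 56 plans to file as `KatoTwinFactsFiveAnContra`; its GZ ∕ Kolyvagin ∕ … overlap `PublishedInputsFive`
  harmlessly; what 19066 does NOT carry: Stein–Wuthrich 6.1 ×2 (items `SteinWuthrich{Split,Nonsplit}LeadingTerm` exist but are asked inside the bundle),
  Greenberg–Stevens, Cha Rmk. 25 LOWER (item `ChaShaStructureCertificate`), Kato 12.4 (item `KatoFinitelyGeneratedIwasawaH2`), V′ ∕ VI′ ∕ XI′ CONTRA (no item:
  `KatoMultDivisibilityInputs*` are the γ-keyed V ∕ VI ∕ XI));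
* `hHida` — the six Hida-side names (no ER5 item; alternatively the crux `X11aLowerHalf` BY NAME implies the leaf-twin lower half a fortiori —
  `lowerLeafTwinDeep_of_x11aLowerHalf` — through glue #8's `h₄ℓ` binder shape; RULING 48 preferred the Hida derivation);
* `hMax2` — Gross 3.7 (2) image-free ∧ GZ86 III (3.1) IMAGE-FREE (no item; 19715's planned `EulerHalfGrossPrintFacts` carries the NON-image-free
  `Gross1991_heegnerPoint_sub_ratTorsion_mem_E0` — the image-free form implies it, not conversely);
* `hLab` — `shimuraCurve_heegnerSystem_primitivesFromFiveIrr` (no item; `ShimuraHeegnerEulerSystemInertPrintedR` is the `…FromFive` fact);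
* `hLabB6T` — slot 6, the (B6)@carriers labelled family ON THE CORNER (no item; 19715's planned `ShimuraCarrierLabelsB6FromFive` covers it only if stated
  image-free for `p ∈ {5,7}` with `p ∈ S`).
So, FOR THE PLANNER: 19065 closes modulo route items as soon as FIVE support items exist — (α) `KatoTwinFactsFiveAnContra` := `hF3`; (β) a six-name Hida
bundle (or 19064 by name); (γ) the two MAX-road names in IMAGE-FREE form; (δ) `primitivesFromFiveIrr`; (ε) the corner (B6) text — after which the
by-name glue is this file's theorem with every displayed binder replaced by the item (one token each), and 19065 re-splits into {19946, 19948, (α), (β)∕19064,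
(γ), (δ), (ε), JL, Pasten, Cassels–Tate inputs} + that glue. Nothing here is registered or filed by this seat (D-0145 ∕ RULING 21).
* `nonSurjCorner_of_items_r16` (Hida names displayed; the 19064-by-name variant would need glue #8's `h₄ℓ` binder shape — not built here).

HONEST FRAMING: ONE THEOREM (no definition, no named fact, no `sorry`); CONDITIONAL on every binder (route items BY NAME + displayed texts); 19065 is
NOT closed by this file; nothing about any curve's BSD; BSD is not advanced; T7.
References (locators only): [cite: PastenShimura2024, Prop. 6.13, Lemma 6.18] [cite: Jetchev2008, Thm. 1.1, Cor. 1.5] [cite: Cha2005, Thm. 21, Rmk. 25]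
[cite: Kato2004Asterisque, Thm. 12.4, §17.13] [cite: GrossLMS1991, §3 Prop. 3.7 (2)] [cite: MilneADT2006, Ch. I Thm. 4.10(b)] [cite: Miller2011LMS, Def. 1.1].
-/

set_option autoImplicit false
set_option linter.dupNamespace false -- `Summit.BirchSwinnertonDyer.BirchSwinnertonDyer` (summit = problem), tree-wide

noncomputable section

open scoped Classical NumberField MatrixGroups ModularForm

namespace Summit.BirchSwinnertonDyer.BirchSwinnertonDyer.Theorems

open CongruenceSubgroup WeierstrassCurve NumberField IsDedekindDomain Field Rat.HeightOneSpectrum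
  Literature.NumberTheory.EllipticCurves
  Literature.NumberTheory.EllipticCurves.ModularForms
  Literature.NumberTheory.Automorphic
  Literature.NumberTheory.EllipticCurves.Rank1Residual
  Literature.NumberTheory.EllipticCurves.Rank1Residual.Typed
  Literature.NumberTheory.EllipticCurves.Wuthrich2014
  Literature.NumberTheory.EllipticCurves.SteinWuthrich2013
  Literature.NumberTheory.EllipticCurves.Greenberg1999
  Literature.NumberTheory.EllipticCurves.Kato2004
  Literature.NumberTheory.EllipticCurves.BarriosEtAl2025
  Literature.NumberTheory.EllipticCurves.EmertonPollackWeston2006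
  Literature.NumberTheory.EllipticCurves.ShimuraCMFamily
  Literature.NumberTheory.GaloisRepresentations Literature.NumberTheory.GaloisCohomology
  Summit.BirchSwinnertonDyer.Rank1Residual
  Summit.BirchSwinnertonDyer.Rank1Residual.X11b
  Summit.BirchSwinnertonDyer.Rank1Residual.X11b.Three.Koly
  Summit.BirchSwinnertonDyer.BirchSwinnertonDyer.Theses.ErratumRoadFive

/-- **r16 keyed on the route's EXISTING items + the four not-yet-item texts displayed (Hida names displayed).** Items BY NAME:
`NonSurjCornerKolyZ` (19946) — restricted inside to slot 1's deep ∕ `Ш_an`-cut form —, `NonSurjCornerTwinMuAn` (19948), `PublishedInputsFive` (19066; its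
conjunct 13 is the inert Friedberg–Hoffstein fact of the Shimura bundle), `ShimuraParametrizationDataNonempty`, `PastenComponentOrdersInput`,
`ShimuraCasselsTateLevelInputs`; displayed: `hF3` (fifteen twin ∕ MAX facts), `hHida` (six), `hMax2` (two, image-free), `hLab` (CM primitives, irreducible
image), `hLabB6T` ((B6)@carriers on the corner). Then glue #18. CONDITIONAL; 19065 NOT closed; T7. -/
theorem nonSurjCorner_of_items_r16
    (hZ : NonSurjCornerKolyZ) (hμ : NonSurjCornerTwinMuAn) (h₅ : PublishedInputsFive)
    (hF3 :
      (∀ (N : ℕ) [NeZero N] (W : WeierstrassCurve ℚ) (K : Type) [Field K] [NumberField K], Literature.NumberTheory.EllipticCurves.gross_zagier N W K) ∧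
      (∀ (N : ℕ) [NeZero N] (W : WeierstrassCurve ℚ) (K : Type) [Field K] [NumberField K], Literature.NumberTheory.EllipticCurves.kolyvagin N W K) ∧
      Literature.NumberTheory.EllipticCurves.Wuthrich2014.sha_dvd_analyticSha ∧
      Literature.NumberTheory.EllipticCurves.rank_eq_analyticRank_of_analyticRank_le_one ∧
      Literature.NumberTheory.EllipticCurves.ModularForms.exists_isNewformOf ∧
      Literature.NumberTheory.EllipticCurves.friedbergHoffstein_exists_heegnerField_split_twist_ne_zero ∧
      Literature.NumberTheory.EllipticCurves.ModularForms.mazur_not_dvd_maninConstant_of_odd ∧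
      Literature.NumberTheory.EllipticCurves.SteinWuthrich2013.thm61_splitMultiplicative ∧
      Literature.NumberTheory.EllipticCurves.SteinWuthrich2013.thm61_nonsplitMultiplicative ∧
      (∀ (W : WeierstrassCurve ℚ) [W.IsElliptic] [W.IsGloballyMinimal] (p : ℕ) [Fact p.Prime], Literature.NumberTheory.EllipticCurves.greenberg_stevens (W := W) (p := p)) ∧
      Literature.NumberTheory.EllipticCurves.Cha2005.rmk25_pow_dvd_card_sha_primary_of_certificate ∧
      Literature.NumberTheory.EllipticCurves.Kato2004.thm12_4 ∧
      Literature.NumberTheory.EllipticCurves.Kato2004.exists_multDivisibilityInputs_nonsplit_contra ∧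
      Literature.NumberTheory.EllipticCurves.Kato2004.exists_multDivisibilityInputs_split_contra ∧
      Literature.NumberTheory.EllipticCurves.Kato2004.exists_multDivisibilityInputs_fine_contra)
    (hHida : EmertonPollackWeston2006.thm311_cotorsion_weightK_member_ofLevel ∧
      EmertonPollackWeston2006.thm1_muAlg_of_weightK_member_ofLevel ∧
      Wan2015.thm4_rational_weightK_member_of_bdd_ofLevel_irred ∧
      EmertonPollackWeston2006.thm513_transfer_from_weightK_member_of_bdd_ofLevel ∧
      DeligneSerre1974.thm61_exists_adicGaloisRep ∧ Hida2000_thm326_ordinary)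
    (hMax2 : GrossLMS1991.prop37_2_frobeniusCongruence ∧ Gross1991_heegnerPoint_sub_ratTorsion_mem_E0_imageFree)
    (hJL : ShimuraParametrizationDataNonempty) (hCO : PastenComponentOrdersInput) (hCTi : ShimuraCasselsTateLevelInputs)
    (hLab : shimuraCurve_heegnerSystem_primitivesFromFiveIrr)
    (hLabB6T : ∀ (W : WeierstrassCurve ℚ) [W.IsElliptic] [W.IsGloballyMinimal] (p : ℕ) [Fact p.Prime],
      ClassX11b W p → ¬ Surj W p → (p = 5 ∨ p = 7) →
      ∀ (N : ℕ) [NeZero N] (K : Type) [Field K] [NumberField K] (S : Finset ℕ) (Dt : ModularParametrizationData W N)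
        (X : ShimuraCurveData (∏ q ∈ S, q) (N / ∏ q ∈ S, q)) (W' : WeierstrassCurve ℚ) [W'.IsElliptic]
        (P₀ : ShimuraParametrizationData X W'),
        W.conductorNorm ℤ = N → IsImaginaryQuadratic K → NumberField.discr K < -4 → Even S.card →
        (∀ ℓ ∈ S, ℓ.Prime ∧ ℓ ∣ N ∧ ¬ ℓ ^ 2 ∣ N ∧
          ((Ideal.span {(ℓ : ℤ)}).primesOver (𝓞 K)).ncard = 1 ∧ ¬ (ℓ : ℤ) ∣ NumberField.discr K) →
        (∀ ℓ : ℕ, ℓ.Prime → ℓ ∣ N → ℓ ∉ S → ((Ideal.span {(ℓ : ℤ)}).primesOver (𝓞 K)).ncard = 2) →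
        p ∈ S → ¬ (p : ℤ) ∣ Dt.c → P₀.IsMinimalFor W →
        ∃ (ι : K →+* ℂ) (y : (W.baseChange K).toAffine.Point) (degy : ℕ)
          (ys : (m : ℕ) → (W.baseChange (ringClassField K ι m)).toAffine.Point) (ε : ℤ), 0 < degy ∧
          padicValNat p degy = padicValNat p P₀.deg ∧
          LDerivEK W K = 8 * (Real.pi : ℂ) ^ 2 * peterssonProduct (CongruenceSubgroup.Gamma0 N) 2 Dt.f Dt.f /
              ((((Units.torsionOrder K : ℝ) / 2) ^ 2 * √|(NumberField.discr K : ℝ)| : ℝ) : ℂ) *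
            ((y.canonicalHeight : ℂ) / (degy : ℂ)) ∧
          (¬ IsOfFinAddOrder y → 0 < (AddSubgroup.zmultiples y).index) ∧
          ShimuraWalk.LabelsAt W N K ι y ys ε ∧
          ∀ (q : ℕ) [Fact q.Prime], q ∣ N → q ∉ S → p ∣ (W.baseChange ℚ_[q]).localTamagawaNumber ℤ_[q] → LabelB6 ι W N {q} ys)
    : NonSurjCorner :=
  nonSurjCorner_of_kolyZShaAn_of_twinMuAn_of_fifteenFacts_of_hidaFacts_of_twoPlusFiveNamedInputs_of_carrierLabelsB6_pAnchor
    (fun W _ _ p _ N _ K _ _ Dt β ι hX hns h57 hv hnr _ hN hK hdisc hHN hHp hβ hc _ ↦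
      hZ W p N K Dt β ι hX hns h57 hv hnr hN hK hdisc hHN hHp hβ hc)
    hμ hF3 hHida hMax2 ⟨h₅.2.2.2.2.2.2.2.2.2.2.2.2.1, hJL, hCO, hCTi, hLab⟩ hLabB6T

end Summit.BirchSwinnertonDyer.BirchSwinnertonDyer.Theorems

end
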